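import Summits.CriticalPhenomena.Ising3DConformalLimit.Theorems.CanonicalBranchRefutationInfraredExponentZeroHalfBet
import HarnessLib

/-!
# The half-bet without loss: `M(m) ≥ c √m` and `⟨σ₀σ_{n e₁}⟩ ≥ c n^{-3/2}` infinitely often
# (crux stmt-CriticalPhenomena-15521 `InfraredExponentZero`, lead c3)

THEOREM-ONLY support file for the crux `CanonicalBranchRefutation.InfraredExponentZero` (the branch
hypothesis `η(3) = 0`, kernel-checked equivalent to the registered stub `stub_sphereMass_growth`:
`M(n) := ∑_{y ∈ ∂Λ_n} ⟨σ₀σ_y⟩⁺_{β_c} ≥ n^{1-ε}` eventually). It sharpens the unconditional floor of the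
stub's shape from `M(m) ≥ m^{1/2-δ}` infinitely often (`sphereMass_frequently_ge_rpow`, every `δ > 0`) to

* `exists_frequently_mul_rpow_le_criticalTwoPoint_axis` — there is `c > 0` with `c n^{-3/2} ≤ ⟨σ₀σ_{n e₁}⟩_{β_c(3)}`
  for infinitely many `n` (`limsup n^{3/2} ⟨σ₀σ_{ne₁}⟩ > 0`, no `n^{o(1)}` loss);
* `exists_frequently_mul_sqrt_le_sphereMass` — there is `c > 0` with `c √m ≤ M(m)` for infinitely many `m`.

Proof: Duminil-Copin–Panis 2025, Theorem 1.3 at `β_c` (tree theorem `dcp_criticalTwoPoint_axis_lower_holds`: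
`⟨σ₀σ_{ne₁}⟩ · (χ_{4n} + n Σ_{k ≤ 2n} k⟨σ₀σ_{ke₁}⟩) ≥ c₁`) run at the critical exponent `3/2` EXACTLY, which
needs the denominator estimate with the head and the tail separated (`dcp_denominator_le_of_eventual_axis`):
if `⟨σ₀σ_{ke₁}⟩ ≤ c k^{-3/2}` for `k ≥ N` then, by the Messager–Miracle-Solé sandwich,
`χ_{4n} + n Σ_{k≤2n} k⟨σ₀σ_{ke₁}⟩ ≤ ((2N+1)³ + N²)·n + 436 c n^{3/2}`, so that
`c₁ ≤ c n^{-3/2}·(A_N n + 436 c n^{3/2}) = c A_N n^{-1/2} + 436 c² < c₁` for `c ≤ min(1, c₁/872)` and `n`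
large — the head is killed by `n^{-1/2} → 0`, the tail by the smallness of `c`. (The tree's
`dcp_denominator_le` needs the bound for ALL `x` with one constant and exponent `b > 1/2`; at `b = 1/2`
that constant would swallow the contradiction.)

Sources: H. Duminil-Copin, R. Panis, CMP 406 (2025) = arXiv:2404.05700, Theorems 1.3 and 1.5
[DuminilCopinPanis2025LowerBounds]; A. Messager, S. Miracle-Solé, J. Stat. Phys. 17 (1977)
[MessagerMiracleSoleJSP1977]. Tree: `dcp_criticalTwoPoint_axis_lower_holds`, `dcp_denominator_pos`,
`sum_box_erase_norm_rpow_le`, `sum_Icc_rpow_sub_one_le`, `criticalTwoPoint_axis_sandwich`,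
`criticalTwoPoint_axis_antitone`, `sq_mul_criticalTwoPoint_axis_le_sphereMass` (p146335).
-/

noncomputable section

namespace Summit.CriticalPhenomena.Ising3DConformalLimit.Theorems

open Filter Topology Finset Literature.Probability.LatticeModels

/-! ## The denominator of Duminil-Copin–Panis (1.9) under an EVENTUAL axis bound at exponent `3/2` -/

/-- **Head/tail denominator estimate.** If `⟨σ₀σ_{k e₁}⟩_{β_c(3)} ≤ c k^{-3/2}` for all `k ≥ N`
(`N ≥ 1`, `c ≥ 0`), then for every `n ≥ 1`
`∑_{x ∈ Λ_{4n}} ⟨σ₀σ_x⟩ + n ∑_{k=1}^{2n} k ⟨σ₀σ_{ke₁}⟩ ≤ ((2N+1)³ + N²) n + 436 c n^{3/2}`: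
the sites with `‖x‖_∞ < N` (resp. `k < N`) contribute at most `(2N+1)³` (resp. `n N²`) since `⟨σ₀σ_x⟩ ≤ 1`;
on the rest the Messager–Miracle-Solé sandwich `⟨σ₀σ_x⟩ ≤ ⟨σ₀σ_{‖x‖_∞ e₁}⟩ ≤ c‖x‖^{-3/2}` and the shell
count `#∂Λ_m ≤ 54 m²` give `≤ 54c·4n·(4n)^{1/2} = 432 c n^{3/2}`, resp. `n·c Σ_{k≤2n} k^{-1/2} ≤ 4 c n^{3/2}`.
[cite: DuminilCopinPanis2025LowerBounds, proof of Theorem 1.5 (arXiv p. 6)] -/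
theorem dcp_denominator_le_of_eventual_axis {c : ℝ} (hc : 0 ≤ c) {N : ℕ} (hN : 1 ≤ N)
    (h : ∀ k : ℕ, N ≤ k → criticalTwoPoint 3 (Pi.single 0 (k : ℤ)) ≤ c * (k : ℝ) ^ (-(3 / 2 : ℝ)))
    {n : ℕ} (hn : 1 ≤ n) :
    (∑ x ∈ box 3 (4 * n), criticalTwoPoint 3 x) +
        (n : ℝ) * ∑ k ∈ Finset.Icc 1 (2 * n), (k : ℝ) * criticalTwoPoint 3 (Pi.single 0 (k : ℤ)) ≤
      (((2 * N + 1) ^ 3 + N ^ 2 : ℕ) : ℝ) * n + 436 * c * (n : ℝ) ^ (3 / 2 : ℝ) := by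
  have hn0 : (0 : ℝ) < n := by exact_mod_cast hn
  have hn1 : (1 : ℝ) ≤ n := by exact_mod_cast hn
  -- `(4n)^{1/2} = 2 √n` and `n^{3/2} = n √n`
  have hsqrt4n : ((4 * n : ℕ) : ℝ) ^ (1 / 2 : ℝ) = 2 * (n : ℝ) ^ (1 / 2 : ℝ) := by
    push_cast
    rw [Real.mul_rpow (by norm_num) hn0.le]
    congr 1
    rw [show (4 : ℝ) = 2 ^ (2 : ℝ) by norm_num, ← Real.rpow_mul (by norm_num)]
    norm_num
  have h32 : (n : ℝ) ^ (3 / 2 : ℝ) = n * (n : ℝ) ^ (1 / 2 : ℝ) := by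
    rw [show (3 / 2 : ℝ) = 1 + 1 / 2 by norm_num, Real.rpow_add hn0, Real.rpow_one]
  -- pointwise tail bound off the box `‖x‖_∞ < N`
  have htail : ∀ x : Site 3, N ≤ Site.supNorm x →
      criticalTwoPoint 3 x ≤ c * ‖x‖ ^ (-(3 / 2 : ℝ)) := by
    intro x hx
    have hm1 : 1 ≤ Site.supNorm x := hN.trans hx
    calc criticalTwoPoint 3 x ≤ criticalTwoPoint 3 (Pi.single 0 (Site.supNorm x : ℤ)) :=
          (criticalTwoPoint_axis_sandwich hm1).2
      _ ≤ c * ((Site.supNorm x : ℕ) : ℝ) ^ (-(3 / 2 : ℝ)) := h _ hx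
      _ = c * ‖x‖ ^ (-(3 / 2 : ℝ)) := by rw [Site.norm_eq_supNorm]
  -- (i) the box sum, head
  have hboxHead : ∑ x ∈ (box 3 (4 * n)).filter (fun x => Site.supNorm x < N), criticalTwoPoint 3 x ≤
      (((2 * N + 1) ^ 3 : ℕ) : ℝ) := by
    calc ∑ x ∈ (box 3 (4 * n)).filter (fun x => Site.supNorm x < N), criticalTwoPoint 3 x
        ≤ ∑ _x ∈ (box 3 (4 * n)).filter (fun x => Site.supNorm x < N), (1 : ℝ) :=
          Finset.sum_le_sum fun x _ => criticalTwoPoint_le_one' x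
      _ = #((box 3 (4 * n)).filter (fun x => Site.supNorm x < N)) := by
          rw [Finset.sum_const, nsmul_eq_mul, mul_one]
      _ ≤ #(box 3 N) := by
          exact_mod_cast Finset.card_le_card fun x hx => by
            rw [Finset.mem_filter] at hx
            exact mem_box_iff_supNorm_le.2 hx.2.le
      _ = (((2 * N + 1) ^ 3 : ℕ) : ℝ) := by rw [card_box]
  -- (i) the box sum, tail
  have hboxTail : ∑ x ∈ (box 3 (4 * n)).filter (fun x => ¬ Site.supNorm x < N), criticalTwoPoint 3 x ≤
      432 * c * (n : ℝ) ^ (3 / 2 : ℝ) := by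
    have hsub : (box 3 (4 * n)).filter (fun x => ¬ Site.supNorm x < N) ⊆ (box 3 (4 * n)).erase 0 := by
      intro x hx
      rw [Finset.mem_filter, not_lt] at hx
      refine Finset.mem_erase.2 ⟨fun h0 => ?_, hx.1⟩
      rw [← Site.supNorm_eq_zero_iff] at h0
      omega
    calc ∑ x ∈ (box 3 (4 * n)).filter (fun x => ¬ Site.supNorm x < N), criticalTwoPoint 3 x
        ≤ ∑ x ∈ (box 3 (4 * n)).filter (fun x => ¬ Site.supNorm x < N), c * ‖x‖ ^ (-(3 / 2 : ℝ)) :=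
          Finset.sum_le_sum fun x hx => htail x (not_lt.1 (Finset.mem_filter.1 hx).2)
      _ ≤ ∑ x ∈ (box 3 (4 * n)).erase 0, c * ‖x‖ ^ (-(3 / 2 : ℝ)) :=
          Finset.sum_le_sum_of_subset_of_nonneg hsub fun x _ _ =>
            mul_nonneg hc (Real.rpow_nonneg (norm_nonneg _) _)
      _ = c * ∑ x ∈ (box 3 (4 * n)).erase 0, ‖x‖ ^ (-(3 / 2 : ℝ)) := by rw [Finset.mul_sum]
      _ ≤ c * (54 * ∑ m ∈ Finset.range (4 * n), ((m : ℝ) + 1) ^ (2 - (3 / 2 : ℝ))) :=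
          mul_le_mul_of_nonneg_left (sum_box_erase_norm_rpow_le (3 / 2) (4 * n)) hc
      _ ≤ c * (54 * ((4 * n : ℕ) * ((4 * n : ℕ) : ℝ) ^ (1 / 2 : ℝ))) := by
          apply mul_le_mul_of_nonneg_left _ hc
          apply mul_le_mul_of_nonneg_left _ (by norm_num)
          have hle : ∀ m ∈ Finset.range (4 * n),
              ((m : ℝ) + 1) ^ (2 - (3 / 2 : ℝ)) ≤ ((4 * n : ℕ) : ℝ) ^ (1 / 2 : ℝ) := by
            intro m hm
            rw [show (2 : ℝ) - 3 / 2 = 1 / 2 by norm_num]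
            have hm' : (m : ℝ) + 1 ≤ ((4 * n : ℕ) : ℝ) := by
              exact_mod_cast Nat.succ_le_of_lt (Finset.mem_range.1 hm)
            exact Real.rpow_le_rpow (by positivity) hm' (by norm_num)
          calc ∑ m ∈ Finset.range (4 * n), ((m : ℝ) + 1) ^ (2 - (3 / 2 : ℝ))
              ≤ ∑ _m ∈ Finset.range (4 * n), ((4 * n : ℕ) : ℝ) ^ (1 / 2 : ℝ) := Finset.sum_le_sum hle
            _ = (4 * n : ℕ) * ((4 * n : ℕ) : ℝ) ^ (1 / 2 : ℝ) := by
                rw [Finset.sum_const, Finset.card_range, nsmul_eq_mul]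
      _ = 432 * c * (n : ℝ) ^ (3 / 2 : ℝ) := by
          rw [hsqrt4n, h32]
          push_cast
          ring
  -- (ii) the axis sum, head
  have haxHead : ∑ k ∈ (Finset.Icc 1 (2 * n)).filter (fun k => k < N),
      (k : ℝ) * criticalTwoPoint 3 (Pi.single 0 (k : ℤ)) ≤ ((N ^ 2 : ℕ) : ℝ) := by
    calc ∑ k ∈ (Finset.Icc 1 (2 * n)).filter (fun k => k < N),
          (k : ℝ) * criticalTwoPoint 3 (Pi.single 0 (k : ℤ))
        ≤ ∑ _k ∈ (Finset.Icc 1 (2 * n)).filter (fun k => k < N), (N : ℝ) := by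
          refine Finset.sum_le_sum fun k hk => ?_
          have hkN : (k : ℝ) ≤ N := by exact_mod_cast (Finset.mem_filter.1 hk).2.le
          calc (k : ℝ) * criticalTwoPoint 3 (Pi.single 0 (k : ℤ)) ≤ (k : ℝ) * 1 :=
                mul_le_mul_of_nonneg_left (criticalTwoPoint_le_one' _) (Nat.cast_nonneg k)
            _ ≤ N := by rw [mul_one]; exact hkN
      _ = #((Finset.Icc 1 (2 * n)).filter (fun k => k < N)) * (N : ℝ) := by
          rw [Finset.sum_const, nsmul_eq_mul]
      _ ≤ (N : ℝ) * N := by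
          apply mul_le_mul_of_nonneg_right _ (Nat.cast_nonneg N)
          have hcard : #((Finset.Icc 1 (2 * n)).filter (fun k => k < N)) ≤ #(Finset.range N) :=
            Finset.card_le_card fun k hk => Finset.mem_range.2 (Finset.mem_filter.1 hk).2
          rw [Finset.card_range] at hcard
          exact_mod_cast hcard
      _ = ((N ^ 2 : ℕ) : ℝ) := by push_cast; ring
  -- (ii) the axis sum, tail
  have haxTail : ∑ k ∈ (Finset.Icc 1 (2 * n)).filter (fun k => ¬ k < N),
      (k : ℝ) * criticalTwoPoint 3 (Pi.single 0 (k : ℤ)) ≤ 4 * c * (n : ℝ) ^ (1 / 2 : ℝ) := by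
    calc ∑ k ∈ (Finset.Icc 1 (2 * n)).filter (fun k => ¬ k < N),
          (k : ℝ) * criticalTwoPoint 3 (Pi.single 0 (k : ℤ))
        ≤ ∑ k ∈ (Finset.Icc 1 (2 * n)).filter (fun k => ¬ k < N), c * (k : ℝ) ^ ((1 / 2 : ℝ) - 1) := by
          refine Finset.sum_le_sum fun k hk => ?_
          obtain ⟨hkI, hkN⟩ := Finset.mem_filter.1 hk
          have hk1 : 1 ≤ k := (Finset.mem_Icc.1 hkI).1
          have hk0 : (0 : ℝ) < k := by exact_mod_cast hk1
          calc (k : ℝ) * criticalTwoPoint 3 (Pi.single 0 (k : ℤ))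
              ≤ (k : ℝ) * (c * (k : ℝ) ^ (-(3 / 2 : ℝ))) :=
                mul_le_mul_of_nonneg_left (h k (not_lt.1 hkN)) hk0.le
            _ = c * ((k : ℝ) ^ (1 : ℝ) * (k : ℝ) ^ (-(3 / 2 : ℝ))) := by rw [Real.rpow_one]; ring
            _ = c * (k : ℝ) ^ ((1 / 2 : ℝ) - 1) := by
                rw [← Real.rpow_add hk0]
                norm_num
      _ ≤ ∑ k ∈ Finset.Icc 1 (2 * n), c * (k : ℝ) ^ ((1 / 2 : ℝ) - 1) :=
          Finset.sum_le_sum_of_subset_of_nonneg (Finset.filter_subset _ _) fun k _ _ =>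
            mul_nonneg hc (Real.rpow_nonneg (Nat.cast_nonneg k) _)
      _ = c * ∑ k ∈ Finset.Icc 1 (2 * n), (k : ℝ) ^ ((1 / 2 : ℝ) - 1) := by rw [Finset.mul_sum]
      _ ≤ c * (((2 * n : ℕ) : ℝ) ^ (1 / 2 : ℝ) / (1 / 2)) :=
          mul_le_mul_of_nonneg_left (sum_Icc_rpow_sub_one_le (by norm_num) (by norm_num) (2 * n)) hc
      _ ≤ c * (((4 * n : ℕ) : ℝ) ^ (1 / 2 : ℝ) / (1 / 2)) := by
          apply mul_le_mul_of_nonneg_left _ hc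
          apply div_le_div_of_nonneg_right _ (by norm_num)
          exact Real.rpow_le_rpow (by positivity) (by push_cast; linarith) (by norm_num)
      _ = 4 * c * (n : ℝ) ^ (1 / 2 : ℝ) := by rw [hsqrt4n]; ring
  -- assemble
  have hbox : ∑ x ∈ box 3 (4 * n), criticalTwoPoint 3 x ≤
      (((2 * N + 1) ^ 3 : ℕ) : ℝ) + 432 * c * (n : ℝ) ^ (3 / 2 : ℝ) := by
    rw [← Finset.sum_filter_add_sum_filter_not _ (fun x => Site.supNorm x < N)]
    exact add_le_add hboxHead hboxTail
  have hax : ∑ k ∈ Finset.Icc 1 (2 * n), (k : ℝ) * criticalTwoPoint 3 (Pi.single 0 (k : ℤ)) ≤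
      ((N ^ 2 : ℕ) : ℝ) + 4 * c * (n : ℝ) ^ (1 / 2 : ℝ) := by
    rw [← Finset.sum_filter_add_sum_filter_not _ (fun k => k < N)]
    exact add_le_add haxHead haxTail
  have hcub : (0 : ℝ) ≤ (((2 * N + 1) ^ 3 : ℕ) : ℝ) := Nat.cast_nonneg _
  calc (∑ x ∈ box 3 (4 * n), criticalTwoPoint 3 x) +
        (n : ℝ) * ∑ k ∈ Finset.Icc 1 (2 * n), (k : ℝ) * criticalTwoPoint 3 (Pi.single 0 (k : ℤ))
      ≤ ((((2 * N + 1) ^ 3 : ℕ) : ℝ) + 432 * c * (n : ℝ) ^ (3 / 2 : ℝ)) +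
          (n : ℝ) * (((N ^ 2 : ℕ) : ℝ) + 4 * c * (n : ℝ) ^ (1 / 2 : ℝ)) :=
        add_le_add hbox (mul_le_mul_of_nonneg_left hax hn0.le)
    _ = (((2 * N + 1) ^ 3 : ℕ) : ℝ) + ((N ^ 2 : ℕ) : ℝ) * n + 436 * c * (n : ℝ) ^ (3 / 2 : ℝ) := by
        rw [h32]; ring
    _ ≤ (((2 * N + 1) ^ 3 : ℕ) : ℝ) * n + ((N ^ 2 : ℕ) : ℝ) * n + 436 * c * (n : ℝ) ^ (3 / 2 : ℝ) := by
        nlinarith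
    _ = (((2 * N + 1) ^ 3 + N ^ 2 : ℕ) : ℝ) * n + 436 * c * (n : ℝ) ^ (3 / 2 : ℝ) := by
        push_cast; ring

/-! ## The axis floor at exponent exactly `3/2`, infinitely often -/

/-- **Sharp subsequence floor (Duminil-Copin–Panis Thm. 1.5 without η-existence and without `n^{o(1)}` loss).**
There is `c > 0` with `c n^{-3/2} ≤ ⟨σ₀σ_{n e₁}⟩_{β_c(3)}` for infinitely many `n`. Proof: with `c₁` the
constant of Theorem 1.3 at `β_c` (`dcp_criticalTwoPoint_axis_lower_holds`, free state = plus state at `β_c`,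
`twoPointPlus_criticalBeta_eq_twoPointFree_holds`) take `c := min 1 (c₁/872)`; if eventually
`⟨σ₀σ_{ne₁}⟩ < c n^{-3/2}`, say from `N` on, then `dcp_denominator_le_of_eventual_axis` and (1.9) give
`c₁ ≤ ⟨σ₀σ_{ne₁}⟩·D(n) ≤ c A_N n^{-1/2} + 436 c² ≤ c A_N n^{-1/2} + c₁/2`, absurd for `n` large.
[cite: DuminilCopinPanis2025LowerBounds, Theorem 1.3 and proof of Theorem 1.5 (arXiv p. 6)] -/
theorem exists_frequently_mul_rpow_le_criticalTwoPoint_axis :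
    ∃ c : ℝ, 0 < c ∧ ∃ᶠ n : ℕ in atTop,
      c * (n : ℝ) ^ (-(3 / 2 : ℝ)) ≤ criticalTwoPoint 3 (Pi.single 0 (n : ℤ)) := by
  -- Theorem 1.3 at `β_c`, `d = 3`, rewritten for the plus state
  obtain ⟨c₁, hc₁, N₁, -, hmain⟩ := dcp_criticalTwoPoint_axis_lower_holds (d := 3) le_rfl
  have hGeq : ∀ x, criticalTwoPoint 3 x = twoPointFree 3 (criticalBeta 3) x :=
    twoPointPlus_criticalBeta_eq_twoPointFree_holds (d := 3) le_rfl
  have hfun : twoPointFree 3 (criticalBeta 3) = criticalTwoPoint 3 := funext fun x => (hGeq x).symm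
  set c : ℝ := min 1 (c₁ / 872) with hc_def
  have hc : 0 < c := lt_min one_pos (by positivity)
  have hc1 : c ≤ 1 := min_le_left _ _
  have hc872 : c ≤ c₁ / 872 := min_le_right _ _
  refine ⟨c, hc, ?_⟩
  by_contra H
  rw [Filter.not_frequently] at H
  obtain ⟨N, hN⟩ := eventually_atTop.1 (H.and (eventually_ge_atTop 1))
  have hN1 : 1 ≤ N := (hN N le_rfl).2
  have hax : ∀ k : ℕ, N ≤ k →
      criticalTwoPoint 3 (Pi.single 0 (k : ℤ)) ≤ c * (k : ℝ) ^ (-(3 / 2 : ℝ)) :=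
    fun k hk => (not_le.1 (hN k hk).1).le
  -- the head constant `A_N` and `c A_N n^{-1/2} → 0`
  set A : ℝ := (((2 * N + 1) ^ 3 + N ^ 2 : ℕ) : ℝ) with hA_def
  have hA : 0 ≤ A := Nat.cast_nonneg _
  have hlim : Tendsto (fun n : ℕ => c * A * (n : ℝ) ^ (-(1 / 2 : ℝ))) atTop (𝓝 0) := by
    have h1 : Tendsto (fun t : ℝ => t ^ (-(1 / 2 : ℝ))) atTop (𝓝 0) :=
      tendsto_rpow_neg_atTop (y := 1 / 2) (by norm_num)
    have h2 : Tendsto (fun n : ℕ => (n : ℝ) ^ (-(1 / 2 : ℝ))) atTop (𝓝 0) :=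
      h1.comp tendsto_natCast_atTop_atTop
    simpa only [mul_zero] using h2.const_mul (c * A)
  obtain ⟨n, hnlt, hnge⟩ :=
    ((hlim.eventually (gt_mem_nhds (half_pos hc₁))).and (eventually_ge_atTop (max N₁ N))).exists
  have hnN₁ : N₁ ≤ n := le_of_max_le_left hnge
  have hnN : N ≤ n := le_of_max_le_right hnge
  have hn1 : 1 ≤ n := hN1.trans hnN
  have hn0 : (0 : ℝ) < n := by exact_mod_cast hn1
  -- (1.9) at this `n`, in plus-state terms
  have h13 := hmain n hnN₁
  have e0 : (⟨0, by norm_num⟩ : Fin 3) = 0 := rfl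
  rw [e0, show (3 - 2 : ℕ) = 1 from rfl, pow_one, hfun] at h13
  have hDpos : 0 < (∑ x ∈ box 3 (4 * n), criticalTwoPoint 3 x) +
      (n : ℝ) * ∑ k ∈ Finset.Icc 1 (2 * n), (k : ℝ) * criticalTwoPoint 3 (Pi.single 0 (k : ℤ)) := by
    have := dcp_denominator_pos (F := criticalTwoPoint 3) (criticalTwoPoint_zero' (d := 3))
      criticalTwoPoint_nonneg' (0 : Fin 3) n
    exact this
  have hDle := dcp_denominator_le_of_eventual_axis hc.le hN1 hax hn1
  have hgn := hax n hnN
  -- `c₁ ≤ g(n) · D(n) ≤ c n^{-3/2} (A n + 436 c n^{3/2}) = c A n^{-1/2} + 436 c²`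
  have hchain : c₁ ≤ c * A * (n : ℝ) ^ (-(1 / 2 : ℝ)) + 436 * c ^ 2 := by
    have h1 : c₁ ≤ criticalTwoPoint 3 (Pi.single 0 (n : ℤ)) *
        ((∑ x ∈ box 3 (4 * n), criticalTwoPoint 3 x) +
          (n : ℝ) * ∑ k ∈ Finset.Icc 1 (2 * n), (k : ℝ) * criticalTwoPoint 3 (Pi.single 0 (k : ℤ))) :=
      (div_le_iff₀ hDpos).1 h13
    have h2 : criticalTwoPoint 3 (Pi.single 0 (n : ℤ)) *
        ((∑ x ∈ box 3 (4 * n), criticalTwoPoint 3 x) +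
          (n : ℝ) * ∑ k ∈ Finset.Icc 1 (2 * n), (k : ℝ) * criticalTwoPoint 3 (Pi.single 0 (k : ℤ))) ≤
        (c * (n : ℝ) ^ (-(3 / 2 : ℝ))) * (A * n + 436 * c * (n : ℝ) ^ (3 / 2 : ℝ)) :=
      mul_le_mul hgn hDle hDpos.le (mul_nonneg hc.le (Real.rpow_nonneg hn0.le _))
    have h3 : (c * (n : ℝ) ^ (-(3 / 2 : ℝ))) * (A * n + 436 * c * (n : ℝ) ^ (3 / 2 : ℝ)) =
        c * A * (n : ℝ) ^ (-(1 / 2 : ℝ)) + 436 * c ^ 2 := by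
      have e1 : (n : ℝ) ^ (-(3 / 2 : ℝ)) * n = (n : ℝ) ^ (-(1 / 2 : ℝ)) := by
        conv_lhs => rw [← Real.rpow_one (n : ℝ), ← Real.rpow_mul hn0.le, ← Real.rpow_add hn0]
        norm_num
      have e2 : (n : ℝ) ^ (-(3 / 2 : ℝ)) * (n : ℝ) ^ (3 / 2 : ℝ) = 1 := by
        rw [← Real.rpow_add hn0]; norm_num
      calc (c * (n : ℝ) ^ (-(3 / 2 : ℝ))) * (A * n + 436 * c * (n : ℝ) ^ (3 / 2 : ℝ))
          = c * A * ((n : ℝ) ^ (-(3 / 2 : ℝ)) * n) +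
              436 * c ^ 2 * ((n : ℝ) ^ (-(3 / 2 : ℝ)) * (n : ℝ) ^ (3 / 2 : ℝ)) := by ring
        _ = c * A * (n : ℝ) ^ (-(1 / 2 : ℝ)) + 436 * c ^ 2 := by rw [e1, e2, mul_one]
    linarith [h1, h2, h3.le, h3.ge]
  -- `436 c² ≤ c₁ / 2` by the choice of `c`
  have hsmall : 436 * c ^ 2 ≤ c₁ / 2 := by nlinarith [hc.le, hc1, hc872]
  linarith

/-- The same in `∀ N, ∃ n ≥ N` form, with the constant exposed. [cite: DuminilCopinPanis2025LowerBounds, Theorem 1.3] -/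
theorem exists_const_forall_exists_ge_mul_rpow_le_criticalTwoPoint_axis :
    ∃ c : ℝ, 0 < c ∧ ∀ N : ℕ, ∃ n : ℕ, N ≤ n ∧
      c * (n : ℝ) ^ (-(3 / 2 : ℝ)) ≤ criticalTwoPoint 3 (Pi.single 0 (n : ℤ)) := by
  obtain ⟨c, hc, hfreq⟩ := exists_frequently_mul_rpow_le_criticalTwoPoint_axis
  exact ⟨c, hc, fun N => Filter.frequently_atTop.1 hfreq N⟩

/-! ## The shell form: `M(m) ≥ c √m` infinitely often -/

/-- **The half-bet without loss.** There is `c > 0` such that the critical sphere masses of the 3D Ising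
model satisfy `c √m ≤ M(m) = ∑_{y ∈ ∂Λ_m} ⟨σ₀σ_y⟩⁺_{β_c}` for infinitely many `m`: the axis floor
`c₀ n^{-3/2} ≤ ⟨σ₀σ_{ne₁}⟩` (infinitely often) moved to the shell `m = ⌊n/3⌋` by axial monotonicity and
`m² ⟨σ₀σ_{3m e₁}⟩ ≤ M(m)` (`sq_mul_criticalTwoPoint_axis_le_sphereMass`), with `n ≤ 5m`:
`M(m) ≥ c₀ m² (5m)^{-3/2} = c₀ 5^{-3/2} √m`. Compare the registered stub `stub_sphereMass_growth` of crux
stmt-CriticalPhenomena-15521 (`M(m) ≥ m^{1-ε}` EVENTUALLY, all `ε > 0`; expected false) and the earlier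
`sphereMass_frequently_ge_rpow` (`m^{1/2-δ}`, every `δ > 0`). [cite: DuminilCopinPanis2025LowerBounds, Theorem 1.3 and Theorem 1.5] -/
theorem exists_frequently_mul_sqrt_le_sphereMass :
    ∃ c : ℝ, 0 < c ∧ ∃ᶠ m : ℕ in atTop,
      c * (m : ℝ) ^ (1 / 2 : ℝ) ≤ ∑ y ∈ sphere 3 m, criticalTwoPoint 3 y := by
  obtain ⟨c₀, hc₀, hfreq⟩ := exists_frequently_mul_rpow_le_criticalTwoPoint_axis
  refine ⟨c₀ * (5 : ℝ) ^ (-(3 / 2 : ℝ)), mul_pos hc₀ (Real.rpow_pos_of_pos (by norm_num) _), ?_⟩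
  rw [Filter.frequently_atTop]
  intro N
  obtain ⟨n, hn, hgn⟩ := Filter.frequently_atTop.1 hfreq (3 * max N 1)
  -- the shell radius `m := ⌊n/3⌋`
  set m : ℕ := n / 3 with hm_def
  have hm3 : 3 * m ≤ n := Nat.mul_div_le n 3
  have hn3 : n < 3 * m + 3 := by omega
  have hmN : max N 1 ≤ m := by omega
  have hm1 : 1 ≤ m := le_of_max_le_right hmN
  have hmN' : N ≤ m := le_of_max_le_left hmN
  refine ⟨m, hmN', ?_⟩
  have hm0 : (0 : ℝ) < m := by exact_mod_cast hm1
  have hn0 : (0 : ℝ) < n := by exact_mod_cast (show 0 < n by omega)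
  -- `⟨σ₀σ_{n e₁}⟩ ≤ ⟨σ₀σ_{3m e₁}⟩` (axial monotonicity, `3m ≤ n`)
  have hanti : criticalTwoPoint 3 (Pi.single 0 (n : ℤ)) ≤
      criticalTwoPoint 3 (Pi.single 0 ((3 * m : ℕ) : ℤ)) :=
    criticalTwoPoint_axis_antitone hm3
  -- `n ≤ 3m + 2 ≤ 5m`, so `5^{-3/2} m^{-3/2} ≤ n^{-3/2}`
  have hn5 : (n : ℝ) ≤ 5 * m := by
    have : n ≤ 5 * m := by omega
    exact_mod_cast this
  have hpow : (5 : ℝ) ^ (-(3 / 2 : ℝ)) * (m : ℝ) ^ (-(3 / 2 : ℝ)) ≤ (n : ℝ) ^ (-(3 / 2 : ℝ)) := by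
    rw [← Real.mul_rpow (by norm_num) hm0.le, Real.rpow_neg (by positivity), Real.rpow_neg hn0.le]
    exact inv_anti₀ (Real.rpow_pos_of_pos hn0 _) (Real.rpow_le_rpow hn0.le hn5 (by norm_num))
  calc c₀ * (5 : ℝ) ^ (-(3 / 2 : ℝ)) * (m : ℝ) ^ (1 / 2 : ℝ)
      = (m : ℝ) ^ 2 * (c₀ * ((5 : ℝ) ^ (-(3 / 2 : ℝ)) * (m : ℝ) ^ (-(3 / 2 : ℝ)))) := by
        have e : (m : ℝ) ^ (1 / 2 : ℝ) = (m : ℝ) ^ 2 * (m : ℝ) ^ (-(3 / 2 : ℝ)) := by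
          rw [← Real.rpow_two, ← Real.rpow_add hm0]; norm_num
        rw [e]; ring
    _ ≤ (m : ℝ) ^ 2 * (c₀ * (n : ℝ) ^ (-(3 / 2 : ℝ))) :=
        mul_le_mul_of_nonneg_left (mul_le_mul_of_nonneg_left hpow hc₀.le) (by positivity)
    _ ≤ (m : ℝ) ^ 2 * criticalTwoPoint 3 (Pi.single 0 (n : ℤ)) :=
        mul_le_mul_of_nonneg_left hgn (by positivity)
    _ ≤ (m : ℝ) ^ 2 * criticalTwoPoint 3 (Pi.single 0 ((3 * m : ℕ) : ℤ)) :=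
        mul_le_mul_of_nonneg_left hanti (by positivity)
    _ ≤ ∑ y ∈ sphere 3 m, criticalTwoPoint 3 y := sq_mul_criticalTwoPoint_axis_le_sphereMass hm1

/-- **Contrapositive (refuter bookkeeping for the averaged exponent).** The critical 3D sphere masses admit
NO eventual bound `M(m) ≤ ε √m` with `ε` below the universal constant of
`exists_frequently_mul_sqrt_le_sphereMass`; in particular `M(m) = o(√m)` is impossible:
`¬ Tendsto (M(m)/√m) atTop (𝓝 0)`. [cite: DuminilCopinPanis2025LowerBounds, Theorem 1.5] -/
theorem not_tendsto_sphereMass_div_sqrt_zero :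
    ¬ Tendsto (fun m : ℕ => (∑ y ∈ sphere 3 m, criticalTwoPoint 3 y) / (m : ℝ) ^ (1 / 2 : ℝ))
      atTop (𝓝 0) := by
  intro hT
  obtain ⟨c, hc, hfreq⟩ := exists_frequently_mul_sqrt_le_sphereMass
  have hev : ∀ᶠ m : ℕ in atTop,
      (∑ y ∈ sphere 3 m, criticalTwoPoint 3 y) / (m : ℝ) ^ (1 / 2 : ℝ) < c :=
    hT.eventually (gt_mem_nhds hc)
  refine ((hev.and (eventually_ge_atTop 1)).and_frequently hfreq).exists.elim fun m hm => ?_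
  obtain ⟨⟨hlt, hm1⟩, hle⟩ := hm
  have hm0 : (0 : ℝ) < (m : ℝ) ^ (1 / 2 : ℝ) := Real.rpow_pos_of_pos (by exact_mod_cast hm1) _
  rw [div_lt_iff₀ hm0] at hlt
  linarith

end Summit.CriticalPhenomena.Ising3DConformalLimit.Theorems

end
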